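import Literature.Computability.Cryptography.OracleGames
import Literature.Computability.Complexity.OracleIdleClock
import Literature.Computability.Complexity.CoinTruncation
import Literature.Computability.Complexity.BrickAlgebra
import Literature.Computability.Complexity.CountingHierarchyProofs
import Literature.Computability.MetaComplexity.HeuristicClassesProofs
import HarnessLib

/-!
# PPT oracle adversaries are closed under polynomial-time input preprocessing

For every probabilistic polynomial-time oracle adversary `𝒜` (C4a model of `OracleGames.lean`:
a deterministic step function `OracleAlg.step`, a polynomial coin budget and a polynomial round
budget, `OracleAdversary.outputPMF`) and every polynomial-time string map `g`, there is a PPT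
oracle adversary `𝒜.precomp g s` whose output law on input `w` — for EVERY deterministic oracle —
is exactly the output law of `𝒜` on input `g w` (`OracleAdversary.outputPMF_precomp`,
`OracleAdversary.exists_ppt_outputPMF_precomp`). This is the routine step "on input `w`, run
`A` on `g(w)`" of countless reductions (e.g. Aaronson–Chen 2017, proof of Thm. 8.1: "given input
`⟨x, 0^{1/ε}⟩`, run `A_M` on input `⟨x, 0^{2/ε}⟩`"); it is the oracle-adversary form of the
tree's `RandAlg.precomp` / `RandAlg.outputPMF_precomp` / `RandAlg.isPolyTime_precomp`
(`MetaComplexity/PromiseRandReductions.lean`, coin-taking algorithms without oracle), which this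
file mirrors. In the transcript model the coin and round budgets of an adversary are polynomials
in the length of ITS OWN input, whence:

* coins: `𝒜.precomp g s` draws `coins(s(|w|)) ≥ coins(|g w|)` coins (`|g w| ≤ s(|w|)`,
  `exists_poly_length_le_of_mem_FP`; `ℕ`-polynomials are monotone) and feeds `𝒜` the prefix of
  the right length (`truncSndFn`, `CoinTruncation.lean`) — a prefix of a uniform string is
  uniform (`map_take_uniformOfFintype_vector`), exactly as in `RandAlg.outputPMF_precomp`;
* rounds: it emulates EXACTLY `fuel(|g w|)` step evaluations of `𝒜` and then idles, so that an
  emulated run exhausting `𝒜`'s budget yields `none` as it should — the none-preserving idle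
  clock `OracleAlg.idleClockFst` of `Complexity/OracleIdleClock.lean` (the clocks `clock`,
  `clockBy`, `clockFst` of `OracleQueryMap.lean`/`OracleClockFst.lean` output a default past the
  budget and would change the output law), composed with the input map by `OracleAlg.comap`
  (`OracleQueryMap.lean`); polynomial time by `isPolyTime_idleClockFst` and `isPolyTime_comap`.

## References

* S. Arora, B. Barak, *Computational Complexity: A Modern Approach*, CUP 2009, §3.4 (oracle
  machines), Def. 7.1 (probabilistic machines), Thm. 2.8 (proof: composition of polynomial-time
  maps), §1.4.1 (clocked simulation).
* O. Goldreich, *Foundations of Cryptography I*, CUP 2001, §3.6 (probabilistic polynomial-time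
  oracle machines as adversaries).
* S. Aaronson, L. Chen, CCC 2017 (arXiv:1612.05903), proof of Thm. 8.1 (p. 32), as a consumer
  (`Literature/Barriers/QuantumAdvantage/PPolyOraclesProofs.lean`, fact `pptPrecompClosure`).
-/

noncomputable section

namespace Literature.Computability.Cryptography

open _root_.Computability Complexity Complexity.Brick

namespace OracleAdversary

variable {β : Type}

/-! ### The preprocessing adversary -/

/-- The transformed deterministic input: from `z = ⟨w, r'⟩` (input and coins of the new
adversary) to `⟨g w, r' ↾ coins(|g w|)⟩` (input and coins of the emulated one).
[cite: AroraBarakCC2009, Def. 7.1 with §3.4] -/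
def precompT (𝒜 : OracleAdversary β) (g : List Bool → List Bool) (z : List Bool) : List Bool :=
  boolPair (g (fstF z)) ((sndF z).take (𝒜.coins.eval (g (fstF z)).length))

/-- **`𝒜.precomp g s`**: the adversary "on input `w`, run `𝒜` on `g w`", for a length bound
`|g w| ≤ s(|w|)`: coins `coins ∘ s`, rounds `fuel ∘ s`, step function the idle re-clocking of
`𝒜` by `fuel(|first field|)` read through the input transformation
(`(𝒜.alg.idleClockFst 𝒜.fuel).comap (𝒜.precompT g)`). The oracle-adversary form of
`RandAlg.precomp`. [cite: AroraBarakCC2009, Def. 7.1 with §3.4] -/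
def precomp (𝒜 : OracleAdversary β) (g : List Bool → List Bool) (s : Polynomial ℕ) :
    OracleAdversary β where
  alg := (𝒜.alg.idleClockFst 𝒜.fuel).comap (𝒜.precompT g)
  coins := 𝒜.coins.comp s
  fuel := 𝒜.fuel.comp s

/-- On a genuine input-and-coins pair the transformed input is `⟨g w, r' ↾ coins(|g w|)⟩`.
[folklore] -/
@[simp] theorem precompT_boolPair (𝒜 : OracleAdversary β) (g : List Bool → List Bool)
    (w r : List Bool) :
    𝒜.precompT g (boolPair w r) = boolPair (g w) (r.take (𝒜.coins.eval (g w).length)) := by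
  simp [precompT, fstF, sndF]

/-- **The deterministic run of the preprocessing adversary** on `⟨w, r⟩` with at least
`fuel(|g w|)` rounds is exactly `𝒜`'s run on `⟨g w, r ↾ coins(|g w|)⟩` within `fuel(|g w|)`
rounds (`OracleAlg.runAux_comap`, `OracleAlg.run_idleClockFst_boolPair`).
[cite: AroraBarakCC2009, §3.4 with §1.4.1] -/
theorem run_precomp_boolPair (𝒜 : OracleAdversary β) (g : List Bool → List Bool) (s : Polynomial ℕ)
    (O : Oracle) (w r : List Bool) {K : ℕ} (hK : 𝒜.fuel.eval (g w).length ≤ K) :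
    (𝒜.precomp g s).alg.run O K (boolPair w r) =
      𝒜.alg.run O (𝒜.fuel.eval (g w).length)
        (boolPair (g w) (r.take (𝒜.coins.eval (g w).length))) := by
  change ((𝒜.alg.idleClockFst 𝒜.fuel).comap (𝒜.precompT g)).runAux O (boolPair w r) K [] = _
  rw [OracleAlg.runAux_comap, precompT_boolPair]
  exact OracleAlg.run_idleClockFst_boolPair 𝒜.alg 𝒜.fuel O (g w) _ hK

/-! ### The output law -/

/-- **The output law of the preprocessing adversary** is that of `𝒜` on `g w`, for every
deterministic oracle, as soon as `s` bounds the length of `g`: the run is `𝒜`'s run on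
`⟨g w, r' ↾ coins(|g w|)⟩` with `fuel(|g w|) ≤ fuel(s(|w|))` rounds (`run_precomp_boolPair`),
and the prefix of length `coins(|g w|) ≤ coins(s(|w|))` of the uniform coin string is uniform
(`map_take_uniformOfFintype_vector`) — as in `RandAlg.outputPMF_precomp`.
[cite: AroraBarakCC2009, Def. 7.1 with §3.4] -/
theorem outputPMF_precomp (𝒜 : OracleAdversary β) {g : List Bool → List Bool} {s : Polynomial ℕ}
    (hs : ∀ w, (g w).length ≤ s.eval w.length) (O : Oracle) (w : List Bool) :
    (𝒜.precomp g s).outputPMF O w = 𝒜.outputPMF O (g w) := by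
  have hc : 𝒜.coins.eval (g w).length ≤ (𝒜.coins.comp s).eval w.length := by
    rw [Polynomial.eval_comp]
    exact TM2Iter.eval_mono _ (hs w)
  have hf : 𝒜.fuel.eval (g w).length ≤ (𝒜.fuel.comp s).eval w.length := by
    rw [Polynomial.eval_comp]
    exact TM2Iter.eval_mono _ (hs w)
  have hrun : ∀ r : List.Vector Bool ((𝒜.coins.comp s).eval w.length),
      (𝒜.precomp g s).alg.run O ((𝒜.precomp g s).fuel.eval w.length) (boolPair w r.toList) =
        𝒜.alg.run O (𝒜.fuel.eval (g w).length)
          (boolPair (g w) (r.toList.take (𝒜.coins.eval (g w).length))) :=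
    fun r => 𝒜.run_precomp_boolPair g s O w r.toList hf
  have e₁ : (𝒜.precomp g s).outputPMF O w =
      ((PMF.uniformOfFintype (List.Vector Bool ((𝒜.coins.comp s).eval w.length))).map
          fun r => r.toList.take (𝒜.coins.eval (g w).length)).map
        fun r : List Bool => 𝒜.alg.run O (𝒜.fuel.eval (g w).length) (boolPair (g w) r) := by
    rw [PMF.map_comp, outputPMF_eq_map]
    exact congrArg
      (fun f : List.Vector Bool ((𝒜.coins.comp s).eval w.length) → Option β =>
        PMF.map f (PMF.uniformOfFintype (List.Vector Bool ((𝒜.coins.comp s).eval w.length))))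
      (funext hrun)
  have e₂ : 𝒜.outputPMF O (g w) =
      ((PMF.uniformOfFintype (List.Vector Bool (𝒜.coins.eval (g w).length))).map
          List.Vector.toList).map
        fun r : List Bool => 𝒜.alg.run O (𝒜.fuel.eval (g w).length) (boolPair (g w) r) := by
    rw [PMF.map_comp, outputPMF_eq_map]
    rfl
  rw [e₁, e₂, Literature.Computability.MetaComplexity.map_take_uniformOfFintype_vector hc]

/-! ### Polynomial time -/

/-- String form of the input transformation: `⟨w, r'⟩ ↦ ⟨g w, r' ↾ coins(|g w|)⟩` is
`truncSndFn coins ∘ fanoutFn (g ∘ fstF) sndF`. [folklore] -/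
theorem precompT_eq (𝒜 : OracleAdversary β) (g : List Bool → List Bool) :
    𝒜.precompT g = truncSndFn 𝒜.coins ∘ fanoutFn (g ∘ fstF) sndF := by
  funext z
  simp [precompT, truncSndFn_boolPair]

/-- The input transformation is polynomial-time for polynomial-time `g` (`truncSndFn_mem_FP`,
`fanoutFn_mem_FP`). [cite: AroraBarakCC2009, Thm. 2.8 (proof)] -/
theorem precompT_mem_FP (𝒜 : OracleAdversary β) {g : List Bool → List Bool} (hg : g ∈ FP) :
    𝒜.precompT g ∈ FP := by
  rw [precompT_eq]
  exact comp_mem_FP (truncSndFn_mem_FP _)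
    (fanoutFn_mem_FP (comp_mem_FP hg fstF_mem_FP) sndF_mem_FP)

/-- **The preprocessing adversary is PPT** when `𝒜` is and `g ∈ FP`: `isPolyTime_idleClockFst`
then `isPolyTime_comap`. [cite: AroraBarakCC2009, Thm. 2.8 (proof) and Def. 7.1] -/
theorem isPPT_precomp (𝒜 : OracleAdversary β) (eb : Encoding β Bool) {g : List Bool → List Bool}
    (hg : g ∈ FP) (h𝒜 : 𝒜.IsPPT eb) (s : Polynomial ℕ) : (𝒜.precomp g s).IsPPT eb :=
  OracleAlg.isPolyTime_comap eb (OracleAlg.isPolyTime_idleClockFst eb h𝒜 𝒜.fuel)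
    (𝒜.precompT_mem_FP hg)

/-- **PPT oracle adversaries are closed under polynomial-time input preprocessing**: for PPT
`𝒜` and polynomial-time `g` there is a PPT adversary with the output law of `𝒜` on `g w`, for
every deterministic oracle and every input `w`. [cite: AroraBarakCC2009, Def. 7.1 with §3.4 and Thm. 2.8 (proof)] -/
theorem exists_ppt_outputPMF_precomp {eb : Encoding β Bool} (𝒜 : OracleAdversary β)
    (h𝒜 : 𝒜.IsPPT eb) {g : List Bool → List Bool}
    (hg : PolyTimeComputable (id : List Bool → List Bool) (id : List Bool → List Bool) g) :
    ∃ 𝒜' : OracleAdversary β, 𝒜'.IsPPT eb ∧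
      ∀ (O : Oracle) (w : List Bool), 𝒜'.outputPMF O w = 𝒜.outputPMF O (g w) := by
  obtain ⟨s, hs⟩ := exists_poly_length_le_of_mem_FP (f := g) hg
  exact ⟨𝒜.precomp g s, 𝒜.isPPT_precomp eb hg h𝒜 s, 𝒜.outputPMF_precomp hs⟩

end OracleAdversary

end Literature.Computability.Cryptography

end
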